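import Mathlib
import Summits.Ventures.FusionMHD.Bench.SAlphaS3W1825A1825Panels1
import Summits.Ventures.FusionMHD.Bench.SAlphaS3W1825A19Panels1
import Literature.MathematicalPhysics.MHD.BallooningSAlphaWitnessInterval
import Summits.Ventures.FusionMHD.Models.SAlphaStableS3A175M7Point
import HarnessLib

/-!
# F3 — THIRD-ROUND HALF-GAP END MOVE AT SHEAR `s = 3` (UPPER END ALONE): `73/40 ∈ U_{3}` — with gridfusion-model-7 (g9)'s
# `SAlphaStableS3A175M7.stableSide_three_74 : SAlpha.StableSide (3) (7/4)` (the LOWER end of the bracket of record, BY NAME, p628723) the first-stability edge of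
# the `s–α` MODEL at `s = 3` lies in `[7/4, 73/40]` (width `3/40` = HALF of ★ #289 (s = 3 second halving, `SAlphaStableS3A175M7Point` + `SAlphaPolyWitnessS3A19`)'s `[7/4, 19/10]`); and `U_{3} ⊇ [73/40, 19/10]` by ONE trial function
(venture LADDER-GRIDFUSION, rung F3; cell `gridfusion`; gridfusion-model-7 (g10), 2026-08-28, in gridfusion-lit-3's finite-element lane.
DIRECTOR RULING 67 (3) / lead RULINGS 9gl, 9gu (3): a COUNTED half-gap END MOVE is a tree theorem putting the edge inside a sub-interval of at most
half the width of the bracket of record; at `s = 3` the bracket of record is ★ #289 (s = 3 second halving, `SAlphaStableS3A175M7Point` + `SAlphaPolyWitnessS3A19`)'s `[7/4, 19/10]` (width `3/20`); the float edge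
`1.815` lies in its LOWER half, so the UPPER end alone halves it: `[7/4, 73/40]` (width `3/40`).)

WHAT IS PROVED (kernel, std axioms; the 2 × 32 interval integrals are `decide +kernel` facts of the 4 Panels files):
* `unstableWitness_1825 : UnstableWitness (3) (73/40) (−32) 32 X X′` and `unstableWitness_19 : UnstableWitness (3) (19/10) (−32) 32 X X′` for the
  SAME explicit `C²` piecewise-quintic `X = trialX 1 1 pieces (−32)` (`2⁶⁰·W ≤` the printed negative integers);
* `unstableWitness_band : ∀ α ∈ Icc (73/40) (19/10), UnstableWitness (3) α (−32) 32 X X′` (lit-3's `unstableWitness_of_mem_Icc`), `not_stableSide_of_mem_band`;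
* ★★★ `endMove_three : StableSide (3) (7/4) ∧ ¬ StableSide (3) (73/40)` — the END MOVE in one statement (lower end = `SAlphaStableS3A175M7.stableSide_three_74` BY NAME).

## THREE COLUMNS
CERTIFIED: in the `s–α` ballooning MODEL at shear `s = 3`, with `U_{3}` = the set of `α` at which some compact window carries an
instability witness (lit-3's `SAlpha.UnstableWitness`): `7/4 ∉ U` (gridfusion-model-7 (g9), Picone/Riccati core + tail) and `[73/40, 19/10] ⊆ U` (this file) ⇒
`inf {α ≥ 7/4 : α ∈ U} ∈ [7/4, 73/40]` CLOSED, width `3/40`; with `model-7's `SAlphaPolyWitnessS3A19.unstableWitness_three_1910` (`19/10`, p622755), the `S3A52` / `S3A555B` bands and lit-3's `SAlphaS3W55` band (★ #284)` the certified unstable set at `s = 3` stays ONE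
connected interval from `73/40` up to `lensHi (3)`.  Monotonicity / continuity of the edge in `α` NOT typed.  VALIDATED (not in the kernel): E–L
shooting edge `α ≈ 1.815` (lit-4 kit j299948); float energies above; the printed fit `α ≈ 0.6 s` (12.100) gives `1.8`.  MODELLED: `s–α` model
(large-aspect-ratio shifted circles, high-`n` ballooning ordering, `θ₀ = 0`, ideal MHD); «unstable» = the MODEL's one-surface energy admits a negative
compactly supported `C¹` trial function (representation step `W̄ < 0 ⇒ δW < 0`, Connor–Hastie–Taylor 1979, quoted in the Literature file, NOT typed);
no device, no `β`-limit, no second-stability claim here.  Citations: Freidberg 2014 §8.7 (p0318), §12.3 (12.38)–(12.40), §12.6.2 (12.96)–(12.100)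
[Freidberg2014]; Mahboubi–Melquiond–Sibut-Pinote 2016 §3.2–3.3 [MahboubiMelquiondSibutpinote2016].
-/

open Literature.Analysis.ValidatedNumerics Literature.Analysis.ValidatedNumerics.PolyMP
open Literature.Analysis.ValidatedNumerics.NumericsMP Literature.Analysis.ValidatedNumerics.ExpPoly
open Literature.MathematicalPhysics.MHD.Ballooning Literature.MathematicalPhysics.MHD.Ballooning.SAlpha
open Literature.MathematicalPhysics.MHD.Ballooning.SAlpha.Spline
open Set

namespace Summit.Ventures.FusionMHD.Bench.SAlphaS3W1825

/-- THE GLUED SEGMENT at `α = 73/40` in summed form. [cite: MahboubiMelquiondSibutpinote2016, Sect. 3.3] -/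
theorem c1825_seg_all :
    FSegOK (splineDensity 3 (73/40) (-32) 1 1 pieces) [1] (2 ^ 60) (panelLeft 1 0) (panelLeft 1 32) (-17042943995019264) (-17042888240136192) := by
  have h := c1825_seg
  norm_num at h
  exact h

/-- THE `[-32, 32]` TRIAL FUNCTION IS A WITNESS AT `(3, 73/40)`: `UnstableWitness 3 (73/40) (-32) 32 X X′`, `2⁶⁰·W ≤ -17042888240136192` (`W ≈ -0.0148`;
enclosure `[-0.0147824, -0.0147823]`). [cite: Freidberg2014, §12.3 eqs. (12.38)–(12.40)] -/
theorem unstableWitness_1825 :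
    UnstableWitness 3 (73/40) (-32) 32 (trialX 1 1 pieces (-32)) (trialX' 1 1 pieces (-32)) := by
  have h := unstableWitness_of_spline (s := 3) (α := 73/40) (a := -32) (h := 1) (m := 1) (ps := pieces)
    one_pos one_pos pieces_ne_nil pieces_match pieces_deriv_match head_zero last_zero c1825_seg_all (by decide)
  rw [pieces_length] at h
  norm_num at h
  exact h

/-- THE GLUED SEGMENT at `α = 19/10` in summed form. [cite: MahboubiMelquiondSibutpinote2016, Sect. 3.3] -/
theorem c19_seg_all :
    FSegOK (splineDensity 3 (19/10) (-32) 1 1 pieces) [1] (2 ^ 60) (panelLeft 1 0) (panelLeft 1 32) (-257509304068734976) (-257509243633008640) := by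
  have h := c19_seg
  norm_num at h
  exact h

/-- THE `[-32, 32]` TRIAL FUNCTION IS A WITNESS AT `(3, 19/10)`: `UnstableWitness 3 (19/10) (-32) 32 X X′`, `2⁶⁰·W ≤ -257509243633008640` (`W ≈ -0.2234`;
enclosure `[-0.2233537, -0.2233537]`). [cite: Freidberg2014, §12.3 eqs. (12.38)–(12.40)] -/
theorem unstableWitness_19 :
    UnstableWitness 3 (19/10) (-32) 32 (trialX 1 1 pieces (-32)) (trialX' 1 1 pieces (-32)) := by
  have h := unstableWitness_of_spline (s := 3) (α := 19/10) (a := -32) (h := 1) (m := 1) (ps := pieces)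
    one_pos one_pos pieces_ne_nil pieces_match pieces_deriv_match head_zero last_zero c19_seg_all (by decide)
  rw [pieces_length] at h
  norm_num at h
  exact h

/-- ★★ THE BAND: the `[-32, 32]` trial function is a witness at EVERY `α ∈ [73/40, 19/10]` (the energy of a fixed trial function is a convex
quadratic polynomial in `α`): `U_{3} ⊇ [73/40, 19/10]`. [cite: Freidberg2014, §12.3 eqs. (12.38)–(12.40)] («… The plasma is unstable», for the band of the MODEL) -/
theorem unstableWitness_band :
    ∀ α ∈ Icc (73/40 : ℝ) (19/10), UnstableWitness 3 α (-32) 32 (trialX 1 1 pieces (-32)) (trialX' 1 1 pieces (-32)) :=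
  unstableWitness_of_mem_Icc unstableWitness_1825 unstableWitness_19

/-- … hence every point of the band carries SOME witness, [cite: Freidberg2014, §12.3 eqs. (12.38)–(12.40)] -/
theorem exists_unstableWitness_of_mem_band {α : ℝ} (hα : α ∈ Icc (73/40 : ℝ) (19/10)) :
    ∃ a b : ℝ, ∃ X X' : ℝ → ℝ, UnstableWitness 3 α a b X X' :=
  ⟨_, _, _, _, unstableWitness_band α hα⟩

/-- … and none is on the stable side. [cite: Freidberg2014, §12.3 eq. (12.40)] -/
theorem not_stableSide_of_mem_band {α : ℝ} (hα : α ∈ Icc (73/40 : ℝ) (19/10)) : ¬ StableSide 3 α := by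
  obtain ⟨a, b, X, X', hw⟩ := exists_unstableWitness_of_mem_band hα
  exact fun hs => hs a b X X' hw

/-- ★★★ THE THIRD-ROUND HALF-GAP END MOVE AT `s = 3` IN ONE STATEMENT: the lower end `7/4` is on the STABLE side (gridfusion-model-7 (g9)'s
`SAlphaStableS3A175M7.stableSide_three_74`, BY NAME) and `73/40` is NOT (this file's witness) — the first-stability edge of the MODEL at `s = 3` lies in the
closed interval `[7/4, 73/40]` of width `3/40`. [cite: Freidberg2014, §12.3 eqs. (12.38)–(12.40)] -/
theorem endMove_three :
    StableSide (3) (7/4) ∧ ¬ StableSide (3) (73/40) :=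
  ⟨Summit.Ventures.FusionMHD.Models.SAlphaStableS3A175M7.stableSide_three_74,
   not_stableSide_of_mem_band ⟨le_rfl, by norm_num⟩⟩

end Summit.Ventures.FusionMHD.Bench.SAlphaS3W1825
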